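import Summits.HodgeConjecture.HodgeConjecture.Theorems.PadicSemiregularLiftHodgeFermatVarietiesPairedOfLargePrimesBoundary
import HarnessLib

/-!
# Short character-sum configurations at a prime POWER: pieces and fibre constancy for `q₀ = p₀^e₀` — line `cancel-by-any-claim-lattice`, crux `HodgeFermatVarieties` (stmt-HodgeConjecture-1334)

Lead c4's programme GS² (removing the hypothesis `p² ∤ m` from S16/GP/GS: the `p²`-CORE). Lead c2's boundary machinery
(`…PairedOfLargePrimesBoundary`) is written for a level `p₀ · n` with `p₀` PRIME; here the first factor is a prime power
`q₀ = p₀^e₀` (or, for the pieces, any odd `q₀ ≥ 5` coprime to `n`):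

* `piece_annihilated_odd` — iterated pair restriction at the primes of `n` (word for word c2's `piece_annihilated`; the
  first factor only enters through the parity and size of the co-levels);
* `fibre_const_of_piece_pow` — FIBRE CONSTANCY at `q₀ = p₀^e₀`: for such a piece, `y ↦ T(crt⁻¹(y,b)) - T(-crt⁻¹(y,b))` is
  invariant under the kernel of `(ℤ/q₀)ˣ → (ℤ/p₀^{e₀-1})ˣ` (c2's proof with the local Fourier lemma
  `parityPart_mul_eq_of_orthogonal` at `d = p₀^{e₀-1}` instead of `d = 1`: the orthogonality only holds for the characters
  of conductor exactly `q₀`, which are the primitive ones).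
So when `p₀² ∣ M` the fibre that a non-even configuration must contain is a coset `y₀ · ker` of `p₀` units (all `p₀`
points of a progression `{x₀ + j(M/p₀)}` are units) — matching Aoki's `σ_{p₀,A}` at such levels, whose `p₀` progression
points are all units. Everything here is proved; no named facts. The dichotomy is the sibling `…FibreOfBoundaryPow`.

References: [Aoki1983] N. Aoki, Math. Ann. 266 (1983) 23–54, Prop. 6.4 and §9.
-/

-- every sibling file of the line declares into `…CancelByAnyClaimLattice.PairedNull` from a differently named module
set_option linter.dupNamespace false

noncomputable section

open Finset
open Literature.AlgebraicGeometry.HodgeTheory Literature.AlgebraicGeometry.HodgeTheory.FermatCharacter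

namespace Summit.HodgeConjecture.HodgeConjecture.Theorems.CancelByAnyClaimLattice

namespace PairedNull

section PiecesPow

variable {q₀ n : ℕ} [NeZero q₀] [NeZero n]

/-- `πq[p']` — reduction from level `q₀ · n` to the prime power `p' ^ v_{p'}(n)` of `n`. Local notation. -/
local notation3 (prettyPrint := false) "πq[" p' "]" =>
  ZMod.castHom ((Nat.ordProj_dvd n p').trans (dvd_mul_left n q₀)) (ZMod (p' ^ n.factorization p'))

/-- `Reg[P, x, z]` — `z` lies in the region of `x` at the primes of `P`: `z ≡ ±x` modulo `p' ^ v_{p'}(n)`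
for every `p' ∈ P`. Local notation. -/
local notation3 (prettyPrint := false) "Reg[" P ", " x ", " z "]" =>
  ∀ p' ∈ (P : Finset ℕ), πq[p'] z = πq[p'] x ∨ πq[p'] z = -(πq[p'] x)

/-- **Iterated pair restriction** (first factor an arbitrary odd `q₀ ≥ 5` coprime to `n`; `q₀` prime is lead c2's
`piece_annihilated`). Let `T : ℤ/(q₀ n) → ℂ` be supported on units, annihilated by every odd primitive character,
with `#supp T + 1 < p'` for every prime `p' ∣ n` (all primes of `n` `≥ 5`). Then for every unit `x` and every set
`P` of primes of `n`, the restriction of `T` to the region `{z : z ≡ ±x (mod p'^{v_{p'}(n)}) ∀ p' ∈ P}` is again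
annihilated by every odd primitive character mod `q₀ n`. [cite: Aoki1983, Prop. 6.4] -/
theorem piece_annihilated_odd (hq₀odd : Odd q₀) (hq₀5 : 5 ≤ q₀) (hcq : q₀.Coprime n)
    (hn5 : ∀ p' ∈ n.primeFactors, 5 ≤ p')
    (T : ZMod (q₀ * n) → ℂ) (hTu : ∀ z, ¬ IsUnit z → T z = 0)
    (hT : ∀ χ : DirichletCharacter ℂ (q₀ * n), χ.Odd → χ.IsPrimitive → ∑ z : ZMod (q₀ * n), T z * χ z = 0)
    (hroom : ∀ p' ∈ n.primeFactors, #(univ.filter fun z : ZMod (q₀ * n) ↦ T z ≠ 0) + 1 < p')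
    {x : ZMod (q₀ * n)} (hx : IsUnit x) :
    ∀ P : Finset ℕ, P ⊆ n.primeFactors →
      ∀ χ : DirichletCharacter ℂ (q₀ * n), χ.Odd → χ.IsPrimitive →
        ∑ z : ZMod (q₀ * n), (if Reg[P, x, z] then T z else 0) * χ z = 0 := by
  classical
  have hn0 : n ≠ 0 := NeZero.ne n
  have hN0 : q₀ * n ≠ 0 := NeZero.ne _
  have hnodd : Odd n := by
    rw [Nat.odd_iff]
    by_contra h2
    have h2n : 2 ∣ n := Nat.dvd_of_mod_eq_zero (by omega)
    have := hn5 2 (Nat.mem_primeFactors.mpr ⟨Nat.prime_two, h2n, hn0⟩)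
    omega
  intro P
  induction P using Finset.induction_on with
  | empty =>
    intro _ χ hχo hχp
    have hall : ∀ z : ZMod (q₀ * n), (if Reg[(∅ : Finset ℕ), x, z] then T z else 0) = T z :=
      fun z ↦ if_pos (fun p' hp' ↦ absurd hp' (Finset.notMem_empty p'))
    simp_rw [hall]
    exact hT χ hχo hχp
  | insert p' P hp'P ih =>
    intro hsub χ hχo hχp
    have hp'mem : p' ∈ n.primeFactors := hsub (mem_insert_self _ _)
    have hPsub : P ⊆ n.primeFactors := (subset_insert _ _).trans hsub
    have ihT := ih hPsub
    set TP : ZMod (q₀ * n) → ℂ := fun z ↦ if Reg[P, x, z] then T z else 0 with hTP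
    have hTPu : ∀ z, ¬ IsUnit z → TP z = 0 := by
      intro z hz; simp only [hTP]; split_ifs <;> simp [hTu z hz]
    have hTPle : #(univ.filter fun z : ZMod (q₀ * n) ↦ TP z ≠ 0) ≤ #(univ.filter fun z : ZMod (q₀ * n) ↦ T z ≠ 0) := by
      refine card_le_card fun z hz ↦ ?_
      rw [mem_filter] at hz ⊢
      refine ⟨mem_univ _, fun h0 ↦ hz.2 ?_⟩
      simp only [hTP, h0, ite_self]
    -- the prime power `q = p'^e ∥ n`
    have hp' : p'.Prime := Nat.prime_of_mem_primeFactors hp'mem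
    have hp'5 : 5 ≤ p' := hn5 p' hp'mem
    set e := n.factorization p' with he
    have he1 : 1 ≤ e := Nat.Prime.factorization_pos_of_dvd hp' hn0 (Nat.dvd_of_mem_primeFactors hp'mem)
    haveI : NeZero (p' ^ e) := ⟨pow_ne_zero _ hp'.ne_zero⟩
    have hqn : p' ^ e ∣ n := Nat.ordProj_dvd n p'
    have hqN : p' ^ e ∣ q₀ * n := hqn.trans (dvd_mul_left n q₀)
    have hp'q₀ : Nat.Coprime p' q₀ :=
      (Nat.Coprime.coprime_dvd_left (Nat.dvd_of_mem_primeFactors hp'mem) hcq.symm)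
    have hdiv : q₀ * n / p' ^ e = q₀ * (n / p' ^ e) := Nat.mul_div_assoc q₀ hqn
    have hcop : (p' ^ e).Coprime (q₀ * n / p' ^ e) := by
      rw [hdiv]
      refine Nat.Coprime.mul_right (Nat.Coprime.pow_left _ hp'q₀) ?_
      exact Nat.Coprime.pow_left _ (Nat.coprime_ordCompl hp' hn0)
    have hq5 : 5 ≤ p' ^ e := le_trans hp'5 (Nat.le_self_pow (by omega) p')
    have hq2 : 2 < p' ^ e := by omega
    -- the co-level `q₀ · (n / p'^e)`: odd, `≥ 5`
    haveI : NeZero (n / p' ^ e) := ⟨fun h0 ↦ by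
      have := Nat.div_mul_cancel hqn
      rw [h0, zero_mul] at this
      exact hn0 this.symm⟩
    have hco_odd : Odd (q₀ * (n / p' ^ e)) := hq₀odd.mul (hnodd.of_dvd_nat (Nat.div_dvd_of_dvd hqn))
    have hco5 : 5 ≤ q₀ * (n / p' ^ e) := le_trans hq₀5 (Nat.le_mul_of_pos_right _ (NeZero.pos _))
    haveI : NeZero (q₀ * (n / p' ^ e)) := ⟨by omega⟩
    set a₀ : (ZMod (p' ^ e))ˣ := (hx.map (πq[p'])).unit with ha₀
    have ha₀v : (a₀ : ZMod (p' ^ e)) = πq[p'] x := IsUnit.unit_spec _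
    -- a free element and the restriction
    have hrestr : ∃ (d : ℕ) (hd : d ∣ p' ^ e) (u : (ZMod (p' ^ e))ˣ),
        (∀ χ' : DirichletCharacter ℂ (p' ^ e), ¬ χ'.FactorsThrough d → χ'.IsPrimitive) ∧
        ZMod.unitsMap hd u = 1 ∧
        ∀ z, TP z ≠ 0 → πq[p'] z ≠ a₀ * u ∧ πq[p'] z ≠ -(a₀ * u) := by
      rcases Nat.lt_or_ge e 2 with he2 | he2
      · have he1' : e = 1 := by omega
        have hprim1 : ∀ χ' : DirichletCharacter ℂ (p' ^ e), ¬ χ'.FactorsThrough 1 → χ'.IsPrimitive := by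
          rw [he1', pow_one]; exact fun χ' h ↦ isPrimitive_of_not_factorsThrough_one_prime hp' χ' h
        have hPC : ∃ χ₂ : DirichletCharacter ℂ (q₀ * (n / p' ^ e)), χ₂.Even ∧ χ₂.IsPrimitive :=
          exists_even_isPrimitive (Or.inl hco_odd) (by omega) (by omega)
        have hcardq : #(univ.filter fun z : ZMod (q₀ * n) ↦ TP z ≠ 0) <
            #(univ.filter fun a : ZMod (p' ^ e) ↦ IsUnit a) := by
          have hunits : #(univ.filter fun a : ZMod (p' ^ e) ↦ IsUnit a) = (p' ^ e).totient := card_filter_isUnit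
          have htot : (p' ^ e).totient = p' - 1 := by rw [he1', pow_one, Nat.totient_prime hp']
          rw [hunits, htot]
          have := hroom p' hp'mem
          omega
        obtain ⟨a₁, ha₁⟩ := free_pair_of_dvd hqN hcop hq2 hprim1 (q₀ * (n / p' ^ e)) hdiv hPC TP hTPu ihT hcardq
        refine ⟨1, one_dvd _, a₀⁻¹ * a₁, hprim1, Subsingleton.elim _ _, fun z hz ↦ ?_⟩
        rw [Units.val_mul, ← mul_assoc, Units.mul_inv, one_mul]
        exact ha₁ z hz
      · have hd : p' ^ (e - 1) ∣ p' ^ e := pow_dvd_pow p' (Nat.sub_le e 1)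
        have hm1 : ZMod.unitsMap hd (-1 : (ZMod (p' ^ e))ˣ) ≠ 1 := by
          refine unitsMap_neg_one_ne_one hd ?_
          calc 2 < 5 := by norm_num
            _ ≤ p' := hp'5
            _ ≤ p' ^ (e - 1) := Nat.le_self_pow (by omega) p'
        have hcardK : #(univ.filter fun z : ZMod (q₀ * n) ↦ TP z ≠ 0) <
            #(univ.filter fun u : (ZMod (p' ^ e))ˣ ↦ ZMod.unitsMap hd u = 1) := by
          rw [card_ker_primePow hp' he2]
          have := hroom p' hp'mem
          omega
        obtain ⟨u, hu, hfreeS⟩ := free_of_card_lt_of_dvd hqN hd hm1 _ a₀ hcardK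
        refine ⟨p' ^ (e - 1), hd, u, fun χ' h ↦ isPrimitive_of_not_factorsThrough_primePow hp' he1 χ' h, hu,
          fun z hz ↦ hfreeS z ?_⟩
        rw [mem_filter]; exact ⟨mem_univ _, hz⟩
    obtain ⟨d, hd, u, hprim, hu, hfree⟩ := hrestr
    have key := restrict_pair_of_dvd hqN hcop hq2 hd hprim TP ihT a₀ u hu hfree χ hχo hχp
    refine Eq.trans (Finset.sum_congr rfl fun z _ ↦ ?_) key
    -- the piece over `insert p' P` is the restriction of the piece over `P`
    congr 1
    have hreg_iff : Reg[insert p' P, x, z] ↔ ((πq[p'] z = πq[p'] x ∨ πq[p'] z = -(πq[p'] x)) ∧ Reg[P, x, z]) :=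
      Finset.forall_mem_insert p' P _
    by_cases h1 : ZMod.castHom hqN (ZMod (p' ^ e)) z = a₀ ∨ ZMod.castHom hqN (ZMod (p' ^ e)) z = -a₀
    · have h1' : πq[p'] z = πq[p'] x ∨ πq[p'] z = -(πq[p'] x) := by rw [← ha₀v]; exact h1
      rw [if_pos h1]
      by_cases h2 : Reg[P, x, z]
      · rw [if_pos (hreg_iff.mpr ⟨h1', h2⟩)]; simp only [hTP, if_pos h2]
      · rw [if_neg (fun h ↦ h2 (hreg_iff.mp h).2)]; simp only [hTP, if_neg h2]
    · have h1' : ¬ (πq[p'] z = πq[p'] x ∨ πq[p'] z = -(πq[p'] x)) := by rw [← ha₀v]; exact h1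
      rw [if_neg h1, if_neg (fun h ↦ h1' (hreg_iff.mp h).1)]

/-! ### Fibre constancy at `q₀ = p₀^e₀` -/

/-- **Fibre constancy at a prime POWER `q₀ = p₀^e₀`.** Let `Tp : ℤ/(q₀ n) → ℂ` (`p₀` prime, `q₀` coprime to `n`,
all primes of `n` `≥ 5`) be annihilated by every odd primitive character and supported on units lying in the region
of a unit `x` at ALL primes of `n`. Then on every fibre `{crt⁻¹(y, b) : y}` the function `z ↦ Tp(z) - Tp(-z)` is
invariant in the unit `y` mod `q₀` under the kernel of `(ℤ/q₀)ˣ → (ℤ/p₀^{e₀-1})ˣ` (for `e₀ = 1`: constant — lead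
c2's `fibre_const_of_piece`). (For a PRIMITIVE `χ₁` mod `q₀`, `b ↦ ∑_y Tp(crt⁻¹(y,b)) χ₁(y)` is supported on the
sign orbit of `x mod n` and orthogonal to the primitive characters of parity `-χ₁(-1)`, so `orbit_sign` relates its
values at `±b`; hence `y ↦ Tp(crt⁻¹(y,b)) - Tp(-crt⁻¹(y,b))` is orthogonal to every character mod `q₀` of conductor
`q₀`, and the local Fourier lemma with `d = p₀^{e₀-1}` applies.) [cite: Aoki1983, §9] -/
theorem fibre_const_of_piece_pow {p₀ e₀ : ℕ} (hp₀ : p₀.Prime) (he₀ : 1 ≤ e₀) (hq₀ : q₀ = p₀ ^ e₀)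
    (hc : q₀.Coprime n) (hn5 : ∀ p' ∈ n.primeFactors, 5 ≤ p')
    (Tp : ZMod (q₀ * n) → ℂ)
    (hTp : ∀ χ : DirichletCharacter ℂ (q₀ * n), χ.Odd → χ.IsPrimitive → ∑ z : ZMod (q₀ * n), Tp z * χ z = 0)
    {x : ZMod (q₀ * n)} (hx : IsUnit x)
    (hsupp : ∀ z, Tp z ≠ 0 → IsUnit z ∧ Reg[n.primeFactors, x, z])
    (b : ZMod n) (hd : p₀ ^ (e₀ - 1) ∣ q₀) (u y : (ZMod q₀)ˣ) (hu : ZMod.unitsMap hd u = 1) :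
    Tp ((ZMod.chineseRemainder hc).symm ((u : ZMod q₀) * y, b)) - Tp (-(ZMod.chineseRemainder hc).symm ((u : ZMod q₀) * y, b)) =
      Tp ((ZMod.chineseRemainder hc).symm (y, b)) - Tp (-(ZMod.chineseRemainder hc).symm (y, b)) := by
  classical
  set D : ZMod q₀ → ℂ := fun a ↦ Tp ((ZMod.chineseRemainder hc).symm (a, b)) -
    Tp (-(ZMod.chineseRemainder hc).symm (a, b)) with hD
  set A : (ZMod n)ˣ := (hx.map (ZMod.castHom (dvd_mul_left n q₀) (ZMod n))).unit with hA
  -- every character mod `q₀` of conductor `q₀` kills `D`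
  have hclaim : ∀ χ₁ : DirichletCharacter ℂ q₀, ¬ χ₁.FactorsThrough (p₀ ^ (e₀ - 1)) →
      ∑ a : ZMod q₀, D a * χ₁ a = 0 := by
    intro χ₁ hχ₁
    have hχ₁p : χ₁.IsPrimitive := by
      subst hq₀; exact isPrimitive_of_not_factorsThrough_primePow hp₀ he₀ χ₁ hχ₁
    set σ : ℂ := χ₁ (-1) with hσ
    have hσsq : σ * σ = 1 := by rw [hσ, ← map_mul, neg_one_mul, neg_neg, map_one]
    have hσpm : σ = 1 ∨ σ = -1 := char_neg_one_eq_or χ₁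
    set H : ZMod n → ℂ := fun b' ↦ ∑ a : ZMod q₀, Tp ((ZMod.chineseRemainder hc).symm (a, b')) * χ₁ a with hH
    -- (i) support of `H` on the sign orbit of `A`
    have hHsupp : ∀ b', H b' ≠ 0 → ∃ u : (ZMod n)ˣ, u * u = 1 ∧ b' = (u : ZMod n) * A := by
      intro b' hb'
      obtain ⟨a, -, ha⟩ := Finset.exists_ne_zero_of_sum_ne_zero hb'
      have hz : Tp ((ZMod.chineseRemainder hc).symm (a, b')) ≠ 0 := fun h0 ↦ ha (by rw [h0, zero_mul])
      obtain ⟨hzu, hreg⟩ := hsupp _ hz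
      obtain ⟨u, hu, hub⟩ := exists_sq_eq_one_of_region (dvd_mul_left n q₀) hx hzu hreg
      refine ⟨u, hu, ?_⟩
      rw [(castHom_crt_symm hc a b').2] at hub
      exact hub
    -- (ii) `H` is orthogonal to the primitive characters of parity `-σ`
    have hHnull : ∀ χ₂ : DirichletCharacter ℂ n, χ₂.IsPrimitive → χ₂ (-1) = -σ →
        ∑ b' : ZMod n, H b' * χ₂ b' = 0 := by
      intro χ₂ hχ₂ hpar
      have hprim := prodChar_isPrimitive hc hχ₁p hχ₂
      have hodd : (DirichletCharacter.changeLevel (dvd_mul_right q₀ n) χ₁ *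
          DirichletCharacter.changeLevel (dvd_mul_left n q₀) χ₂).Odd := by
        rw [DirichletCharacter.Odd, prodChar_neg_one, hpar, ← hσ]
        linear_combination (-1 : ℂ) * hσsq
      have key := hTp _ hodd hprim
      rw [sum_mul_prodChar_eq hc] at key
      simp_rw [Finset.mul_sum] at key
      rw [Finset.sum_comm] at key
      rw [← key]
      refine Finset.sum_congr rfl fun b' _ ↦ ?_
      rw [hH, Finset.sum_mul]
      exact Finset.sum_congr rfl fun a _ ↦ by ring
    -- (iii) the sign-orbit lemma
    have hτ : (-σ = 1 ∨ -σ = -1) := by rcases hσpm with h | h <;> rw [h] <;> norm_num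
    have horbit := orbit_sign n hn5 (-σ) hτ H A hHsupp hHnull
    -- (iv) `∑ D χ₁ = H b - σ H(-b) = 0`
    have hneg : ∑ a : ZMod q₀, Tp (-(ZMod.chineseRemainder hc).symm (a, b)) * χ₁ a = σ * H (-b) := by
      rw [hH, Finset.mul_sum, ← Equiv.sum_comp (Equiv.neg (ZMod q₀))]
      refine Finset.sum_congr rfl fun a _ ↦ ?_
      rw [Equiv.neg_apply, ← crt_symm_neg, neg_neg,
        show χ₁ (-a) = χ₁ (-1) * χ₁ a by rw [← map_mul, neg_one_mul], ← hσ]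
      ring
    have hsplit : ∑ a : ZMod q₀, D a * χ₁ a = H b - ∑ a : ZMod q₀, Tp (-(ZMod.chineseRemainder hc).symm (a, b)) * χ₁ a := by
      rw [hH, ← Finset.sum_sub_distrib]
      exact Finset.sum_congr rfl fun a _ ↦ by rw [hD]; ring
    rw [hsplit, hneg, horbit b]
    linear_combination (-(H b)) * hσsq
  -- local Fourier lemma with `d = p₀^(e₀-1)`: `D` is invariant under the kernel of the reduction mod `d`
  have h1 := parityPart_mul_eq_of_orthogonal hd D (Or.inl rfl) (fun χ₁ _ hχ₁ ↦ hclaim χ₁ hχ₁) u y hu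
  have h2 := parityPart_mul_eq_of_orthogonal hd D (Or.inr rfl) (fun χ₁ _ hχ₁ ↦ hclaim χ₁ hχ₁) u y hu
  have h3 : (2 : ℂ) * D ((u : ZMod q₀) * y) = 2 * D y := by linear_combination h1 + h2
  have h4 := mul_left_cancel₀ (two_ne_zero (α := ℂ)) h3
  simpa only [hD] using h4

/-! ### Even, or a full kernel-coset fibre, at a prime power (ℕ-valued configurations) -/

/-- **Even, or a full fibre, at a prime power `q₀ = p₀^e₀`.** Let `p₀ ≥ 5` be a prime, `q₀ = p₀^e₀` (`e₀ ≥ 1`)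
coprime to `n`, all prime factors of `n` `≥ 5`, and let `T : ℤ/(q₀ n) → ℂ` take values in `ℕ`, vanish off the units,
be annihilated by every odd primitive character mod `q₀ n`, and have `#supp T + 1 < p'` for every prime `p' ∣ n`.
Then either `T(-z) = T(z)` for all `z`, or for some unit `b` mod `n` and some unit `y₀` mod `q₀` the whole coset fibre
`{crt⁻¹(u y₀, b) : u ≡ 1 (mod p₀^{e₀-1})}` (`p₀` points if `e₀ ≥ 2`, all `p₀ - 1` units if `e₀ = 1`) lies in the support
of `T`. [cite: Aoki1983, Prop. 6.4 and §9] -/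
theorem even_or_fibre_of_boundary_pow_nat {p₀ e₀ : ℕ} (hp₀ : p₀.Prime) (hp₀5 : 5 ≤ p₀) (he₀ : 1 ≤ e₀)
    (hq₀ : q₀ = p₀ ^ e₀) (hn5 : ∀ p' ∈ n.primeFactors, 5 ≤ p') (hc : q₀.Coprime n) (hd : p₀ ^ (e₀ - 1) ∣ q₀)
    (T : ZMod (q₀ * n) → ℂ) (hN : ∀ z, ∃ k : ℕ, T z = k) (hTu : ∀ z, ¬ IsUnit z → T z = 0)
    (hT : ∀ χ : DirichletCharacter ℂ (q₀ * n), χ.Odd → χ.IsPrimitive → ∑ z : ZMod (q₀ * n), T z * χ z = 0)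
    (hroom : ∀ p' ∈ n.primeFactors, #(univ.filter fun z : ZMod (q₀ * n) ↦ T z ≠ 0) + 1 < p') :
    (∀ z, T (-z) = T z) ∨
      ∃ b : ZMod n, IsUnit b ∧ ∃ y₀ : (ZMod q₀)ˣ, ∀ u : (ZMod q₀)ˣ, ZMod.unitsMap hd u = 1 →
        T ((ZMod.chineseRemainder hc).symm ((u : ZMod q₀) * y₀, b)) ≠ 0 := by
  classical
  have hq₀odd : Odd q₀ := by rw [hq₀]; exact (hp₀.odd_of_ne_two (by omega)).pow
  have hq₀5 : 5 ≤ q₀ := by rw [hq₀]; exact le_trans hp₀5 (Nat.le_self_pow (by omega) p₀)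
  by_cases hev : ∀ z, T (-z) = T z
  · exact Or.inl hev
  right
  push Not at hev
  obtain ⟨z₀, hz₀⟩ := hev
  have hz₀u : IsUnit z₀ := by
    by_contra hnu
    exact hz₀ (by rw [hTu z₀ hnu, hTu (-z₀) (fun h ↦ hnu (by simpa using h.neg))])
  -- the piece of `T` around `z₀`
  set Tp : ZMod (q₀ * n) → ℂ := fun z ↦ if Reg[n.primeFactors, z₀, z] then T z else 0 with hTp
  have hTpann := piece_annihilated_odd hq₀odd hq₀5 hc hn5 T hTu hT hroom hz₀u n.primeFactors (subset_refl _)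
  have hTpsupp : ∀ z, Tp z ≠ 0 → IsUnit z ∧ Reg[n.primeFactors, z₀, z] := by
    intro z hz
    by_cases hreg : Reg[n.primeFactors, z₀, z]
    · refine ⟨?_, hreg⟩
      by_contra hnu
      exact hz (by simp only [hTp, if_pos hreg, hTu z hnu])
    · exact absurd (by simp only [hTp, if_neg hreg]) hz
  have hTpval : ∀ z, Tp z ≠ 0 → Tp z = T z := by
    intro z hz
    by_cases hreg : Reg[n.primeFactors, z₀, z]
    · simp only [hTp, if_pos hreg]
    · exact absurd (by simp only [hTp, if_neg hreg]) hz
  have hTpreg : ∀ z, Reg[n.primeFactors, z₀, z] → Tp z = T z := fun z hreg ↦ by simp only [hTp, if_pos hreg]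
  have hregz₀ : Reg[n.primeFactors, z₀, z₀] := fun p' _ ↦ Or.inl rfl
  have hregnz₀ : Reg[n.primeFactors, z₀, -z₀] := fun p' _ ↦ Or.inr (by rw [map_neg])
  -- coordinates of `z₀`
  set y₀u : (ZMod q₀)ˣ := (hz₀u.map (ZMod.castHom (dvd_mul_right q₀ n) (ZMod q₀))).unit with hy₀u
  set b₀ : ZMod n := ZMod.castHom (dvd_mul_left n q₀) (ZMod n) z₀
  have hb₀u : IsUnit b₀ := hz₀u.map _
  have hz₀eq : (ZMod.chineseRemainder hc).symm ((y₀u : ZMod q₀), b₀) = z₀ := by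
    rw [hy₀u, IsUnit.unit_spec]; exact crt_symm_castHom hc z₀
  have hnz₀eq : (ZMod.chineseRemainder hc).symm ((((-y₀u : (ZMod q₀)ˣ)) : ZMod q₀), -b₀) = -z₀ := by
    rw [Units.val_neg, crt_symm_neg, hz₀eq]
  -- kernel-coset constancy on the fibres over `b₀` and over `-b₀`
  have hconst := fun u y hu ↦ fibre_const_of_piece_pow hp₀ he₀ hq₀ hc hn5 Tp hTpann hz₀u hTpsupp b₀ hd u y hu
  have hconst' := fun u y hu ↦ fibre_const_of_piece_pow hp₀ he₀ hq₀ hc hn5 Tp hTpann hz₀u hTpsupp (-b₀) hd u y hu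
  -- values: `Tp z ∈ ℕ`
  have hTpN : ∀ z, ∃ k : ℕ, Tp z = k := by
    intro z
    by_cases hz : Tp z = 0
    · exact ⟨0, by rw [hz, Nat.cast_zero]⟩
    · rw [hTpval z hz]; exact hN z
  obtain ⟨k₀, hk₀⟩ := hN z₀
  obtain ⟨k₁, hk₁⟩ := hN (-z₀)
  have hk : k₀ ≠ k₁ := by
    rintro rfl
    exact hz₀ (by rw [hk₀, hk₁])
  rcases Nat.lt_or_gt_of_ne hk with hlt | hlt
  · -- `T z₀ < T(-z₀)`: the coset fibre of `-y₀` over `-b₀` lies in the support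
    refine ⟨-b₀, hb₀u.neg, -y₀u, fun u hu ↦ ?_⟩
    have hD := hconst' u (-y₀u) hu
    -- the base value `D'(-y₀) = T(-z₀) - T(z₀)`
    have hbase : Tp ((ZMod.chineseRemainder hc).symm ((((-y₀u : (ZMod q₀)ˣ)) : ZMod q₀), -b₀)) -
        Tp (-(ZMod.chineseRemainder hc).symm ((((-y₀u : (ZMod q₀)ˣ)) : ZMod q₀), -b₀)) = k₁ - k₀ := by
      rw [hnz₀eq, neg_neg, hTpreg _ hregnz₀, hTpreg _ hregz₀, hk₀, hk₁]
    rw [hbase] at hD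
    obtain ⟨a, ha⟩ := hTpN ((ZMod.chineseRemainder hc).symm ((u : ZMod q₀) * ((-y₀u : (ZMod q₀)ˣ) : ZMod q₀), -b₀))
    obtain ⟨c, hc'⟩ := hTpN (-(ZMod.chineseRemainder hc).symm ((u : ZMod q₀) * ((-y₀u : (ZMod q₀)ˣ) : ZMod q₀), -b₀))
    have hsum : a + k₀ = c + k₁ := by
      have h : (a : ℂ) + k₀ = c + k₁ := by
        rw [ha, hc'] at hD
        linear_combination hD
      exact_mod_cast h
    have hTpne : Tp ((ZMod.chineseRemainder hc).symm ((u : ZMod q₀) * ((-y₀u : (ZMod q₀)ˣ) : ZMod q₀), -b₀)) ≠ 0 := by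
      rw [ha]
      exact_mod_cast show a ≠ 0 by omega
    rwa [← hTpval _ hTpne]
  · -- `T(-z₀) < T z₀`: the coset fibre of `y₀` over `b₀` lies in the support
    refine ⟨b₀, hb₀u, y₀u, fun u hu ↦ ?_⟩
    have hD := hconst u y₀u hu
    have hbase : Tp ((ZMod.chineseRemainder hc).symm ((y₀u : ZMod q₀), b₀)) -
        Tp (-(ZMod.chineseRemainder hc).symm ((y₀u : ZMod q₀), b₀)) = k₀ - k₁ := by
      rw [hz₀eq, hTpreg _ hregz₀, hTpreg _ hregnz₀, hk₀, hk₁]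
    rw [hbase] at hD
    obtain ⟨a, ha⟩ := hTpN ((ZMod.chineseRemainder hc).symm ((u : ZMod q₀) * (y₀u : ZMod q₀), b₀))
    obtain ⟨c, hc'⟩ := hTpN (-(ZMod.chineseRemainder hc).symm ((u : ZMod q₀) * (y₀u : ZMod q₀), b₀))
    have hsum : a + k₁ = c + k₀ := by
      have h : (a : ℂ) + k₁ = c + k₀ := by
        rw [ha, hc'] at hD
        linear_combination hD
      exact_mod_cast h
    have hTpne : Tp ((ZMod.chineseRemainder hc).symm ((u : ZMod q₀) * (y₀u : ZMod q₀), b₀)) ≠ 0 := by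
      rw [ha]
      exact_mod_cast show a ≠ 0 by omega
    rwa [← hTpval _ hTpne]

end PiecesPow

/-- **GS²-L1 `stub_fibre_of_boundary_pow_nat`** (registered form of `even_or_fibre_of_boundary_pow_nat`). [cite: Aoki1983, Prop. 6.4 and §9] -/
theorem stub_fibre_of_boundary_pow_nat : ∀ (p₀ e₀ n : ℕ) [NeZero p₀] [NeZero n], p₀.Prime → 5 ≤ p₀ → 1 ≤ e₀ → (∀ p' ∈ n.primeFactors, 5 ≤ p') → ∀ (hc : (p₀ ^ e₀).Coprime n) (hd : p₀ ^ (e₀ - 1) ∣ p₀ ^ e₀) (T : ZMod (p₀ ^ e₀ * n) → ℂ), (∀ z, ∃ k : ℕ, T z = k) → (∀ z, ¬ IsUnit z → T z = 0) → (∀ χ : DirichletCharacter ℂ (p₀ ^ e₀ * n), χ.Odd → χ.IsPrimitive → ∑ z : ZMod (p₀ ^ e₀ * n), T z * χ z = 0) → (∀ p' ∈ n.primeFactors, #(univ.filter fun z : ZMod (p₀ ^ e₀ * n) ↦ T z ≠ 0) + 1 < p') → (∀ z, T (-z) = T z) ∨ ∃ b : ZMod n, IsUnit b ∧ ∃ y₀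 : (ZMod (p₀ ^ e₀))ˣ, ∀ u : (ZMod (p₀ ^ e₀))ˣ, ZMod.unitsMap hd u = 1 → T ((ZMod.chineseRemainder hc).symm ((u : ZMod (p₀ ^ e₀)) * y₀, b)) ≠ 0 :=
  fun _ _ _ _ _ hp₀ hp₀5 he₀ hn5 hc hd T hN hTu hT hroom ↦
    even_or_fibre_of_boundary_pow_nat hp₀ hp₀5 he₀ rfl hn5 hc hd T hN hTu hT hroom

end PairedNull

end Summit.HodgeConjecture.HodgeConjecture.Theorems.CancelByAnyClaimLattice

end
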